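/-
Copyright: the b2b-balaban T⁴-continuum CRUX team, row NE7b OWNER lineage `t4-ne7b-p1` (gen 125). Project licence.
-/
import Summits.QuantumFields.BalabanUV.T4Continuum.Spine.NE7b.SupZdPerturbedPotentialLipschitz
import Summits.QuantumFields.BalabanUV.T4Continuum.Spine.NE7b.SupZdKernelResponseLipschitz

/-!
# THE `H + K` COLUMN'S RESPONSE AND FLUCTUATION COVARIANCE ARE LIPSCHITZ IN THE POTENTIAL, ON `ℤ^d`: for two potentials
# `V₁, V₂ : ℤ^d → [−λ, Λ]` with `|V₁ − V₂| ≤ D`, one kernel `|K(p,q)| ≤ εe^{−γ|p−q|₁}`, ANY decaying perturbed block columns `Ψ^K_j` of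
# `H_{V_j} + K` with decaying inverses `N_j` of their coarse operators ((235)'s objects), every source `f` and solutions `u_j` of
# `(H_{V_j} + K)u_j = f` (`u₁` bounded, `u₂` of block profile `C_ue^{−μ|blk n p − b₀|₁}`): (i) `u₁ − u₂` and its block means are
# `≤ 2C_P′K_{δ₀′−μ}DC_ue^{−μ|· − b₀|₁}`; (ii) the response kernels `h_j(b″,p) = Σ′_{b′}N_j(b′,b″)Ψ^K_j(b′,p)` differ by
# `≤ L_he^{−(ν∕4)|blk n p − b″|₁}`;
# (iii) the fluctuation parts `C_jf = u_j − Σ″m_j(b″)h_j(b″,·)` differ by `≤ (L_u + (L_uC_h + C_uL_h)K_{μ−ν∕4})e^{−(ν∕4)|blk n p − b₀|₁}`, every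
# `L` carrying a factor `D` — the `V`-twin of (224)∕(223)∕(225) (Lipschitz in `K`), by (235) (columns, coarse operators, inverses), (245)
# (response split) and §1's abstract covariance split; (216)'s profile lemma on (235) §1's difference equation for the solutions
# (row NE7b, node U5c; (214)∕(216)∕(234)∕(235)∕(245) BY NAME; [folklore])

Cell `pub-balaban`, sub-cell `t4`, spine estimate NE7b (`T4WeightBudget.RelWeightBound`; the cell's OWN estimate — NOT PRINTED in
[Bałaban 1983–89], NOT PROVED).  Crux-route work under `Spine/NE7b/` by the row OWNER (`t4-ne7b-p1` gen 125, file (249)) under FREEZE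
(0)'s crux-prover clause; NOTHING of Bałaban's is named as a Lean object, valued or asserted; no `T4Continuum/Support` leaf typed; no `def`,
no notation (block means, response kernels and fluctuation parts WRITTEN OUT; the block columns, inverses and solutions are ANY families
with the displayed properties); zero `sorry`.  Imports (BY NAME): the OWNER's (235) `…SupZdPerturbedPotentialLipschitz`
(`perturbed_difference_equation`, `zd_perturbed_hessian_lipschitz_potential`; through it (234) `coarse_entry_le`, (222) `K_pos`, (216)
`zd_perturbed_profile`, (191) `natAbs_sub_comm_sum`), (245) `…SupZdKernelResponseLipschitz` (`conv_term_le`, `response_lipschitz`);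
Mathlib's `Summable.tsum_sub`, `Summable.tsum_add`, `Summable.congr`.

WHY (located).  The road's data is the background field, read by the column through the potential `V`; every next-scale object of the
`H + K` column must be Lipschitz in `V` exactly as the LINEAR column's were ((184)∕(192)∕(202)∕(210)).  (235) did the block columns, the
coarse operators and their inverses; (245) isolated the response split as kernel algebra.  What remained: the SOLUTIONS of
`(H_V + K)u = f` for a general source (one subtraction — (235) §1 — and (216)'s profile lemma for ANY bounded solution: the difference solves
the `V₁`-equation with the profile source `(V₂ − V₁)u₂`), and the covariance's split `C₁f − C₂f = (u₁ − u₂) − Σ″[(m₁ − m₂)h₁ + m₂(h₁ − h₂)]`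
((225)'s pattern), which §1 states ONCE as abstract kernel algebra (two no-loss convolutions of the rates `ν∕4 < μ`, (214)) so that the
`K`-dependence ((225)) and the `V`-dependence (here) are the same lemma read at different Lipschitz inputs.

WHAT IS PROVED ([folklore]): §1 **`fluctuation_split`** (kernel algebra: block-mean profiles `C_m, L_m` at rate `μ` from `b₀`, response
profiles `C_h, L_h` at rate `α < μ` from `blk n p`, `|u₁ − u₂|(p) ≤ L_ue^{−μ|blk n p − b₀|₁}` ⟹ both series `Σ″m_jh_j` converge absolutely and
`|C₁f − C₂f|(p) ≤ (L_u + (L_mC_h + C_mL_h)K_{μ−α})e^{−α|blk n p − b₀|₁}`); §2 **`response_kernel_bounds`** ((245) read at `ν_L ≤ ν`: decay of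
`h₁` with constant `(C_N + L_N)C_ΨK_{μ−ν_L}` and ONE-rate Lipschitz bound `(L_NC_ΨK_{μ−ν_L} + C_NL_ΨK_{μ−ν})e^{−ν_L|blk n p − b″|₁}`); §3
**`zd_perturbed_solution_lipschitz_potential`** (`∃ C₀′ C_P′ δ₀′ > 0`: solutions and block means, (i)); §4 THE END
**`zd_perturbed_covariance_lipschitz_potential`** (`∃ C₀ C_P δ₀ C₀′ C_P′ δ₀′ > 0`: (ii) and (iii) for ANY objects with (235)'s clauses); §5 toy.

HONEST (what this is NOT).  Pointwise kernel statements in the decay currency, final rate `ν∕4` (inherited from (235) (iii); no attempt at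
`ν`); TWO constant triples ((216)'s for the columns via (235), (216)'s again for the solutions — each behind its own `∃`, the recorded
packaging constraint); no operator packaging; nothing of the torus; scalar skeleton ((A3), NC-NE7b-α UNRULED); nothing of the covariant
propagators of [B4]–[B6]; nothing of Bałaban's asserted.  BY-NAME EFFECT ON THE WALL: NONE.  NE7b NOT PRINTED ∕ NOT PROVED; spine PROVED
0∕9; rung (B)+1 — the programme's measures remain FINITE-torus statements; NOT the mass gap, NOT Clay.  HONEST DEPENDENCY: continuum YM
on T⁴ ⇐ BetaPertH ∧ nine spine estimates (0∕9 proved); BetaPertH ⇐ (D1) ∧ (D4) ∧ CAP+tail; G-an2-4 gates asym, D1 and NE2∕3∕4.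
-/

set_option autoImplicit false

noncomputable section

namespace Summit.QuantumFields.BalabanUV.T4Continuum.NE7b.SupZdPerturbedCovariancePotentialLipschitz

open Real Filter Topology
open Literature.MathematicalPhysics.QuantumFieldTheory.Balaban1983to89
open B6QGQLower276 (X e blk B mem_B)
open SupZdCoarseForm (natAbs_sub_comm_sum)
open SupZdPerturbedColumn (K_pos)
open SupZdPerturbedCoarseEntries (zd_perturbed_profile)
open SupZdPerturbedCoarseForm (coarse_entry_le)
open SupZdPerturbedPotentialLipschitz (perturbed_difference_equation zd_perturbed_hessian_lipschitz_potential)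
open SupZdKernelResponseLipschitz (conv_term_le response_lipschitz)

variable {d : ℕ}

/-! ## §1. Kernel algebra: the covariance split -/

/-- **THE COVARIANCE SPLIT**: block means `m₁, m₂` with `|m₂(b″)| ≤ C_me^{−μ|b″−b₀|₁}`, `|m₁ − m₂|(b″) ≤ L_me^{−μ|b″−b₀|₁}`, response profiles
`|h₁(b″)| ≤ C_he^{−α|x−b″|₁}`, `|h₁ − h₂|(b″) ≤ L_he^{−α|x−b″|₁}` with `0 ≤ α < μ`, and values `|v₁ − v₂| ≤ L_ue^{−μ|x−b₀|₁}` ⟹ both series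
`Σ″m_jh_j` converge absolutely and `|(v₁ − Σ″m₁h₁) − (v₂ − Σ″m₂h₂)| ≤ (L_u + (L_mC_h + C_mL_h)K_{μ−α})e^{−α|x−b₀|₁}` — the split
`m₁h₁ − m₂h₂ = (m₁ − m₂)h₁ + m₂(h₁ − h₂)` and (214)'s no-loss convolution twice ((245) §1). [folklore] -/
theorem fluctuation_split {Cm Lm Ch Lh Lu μ α : ℝ} (hα : 0 ≤ α) (hαμ : α < μ) (m₁ m₂ h₁ h₂ : X d → ℝ) (x b₀ : X d) (v₁ v₂ : ℝ)
    (hm₂ : ∀ b'', |m₂ b''| ≤ Cm * exp (-(μ * ∑ i, (((b'' i - b₀ i).natAbs : ℕ) : ℝ))))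
    (hmd : ∀ b'', |m₁ b'' - m₂ b''| ≤ Lm * exp (-(μ * ∑ i, (((b'' i - b₀ i).natAbs : ℕ) : ℝ))))
    (hh₁ : ∀ b'', |h₁ b''| ≤ Ch * exp (-(α * ∑ i, (((x i - b'' i).natAbs : ℕ) : ℝ))))
    (hhd : ∀ b'', |h₁ b'' - h₂ b''| ≤ Lh * exp (-(α * ∑ i, (((x i - b'' i).natAbs : ℕ) : ℝ))))
    (hv : |v₁ - v₂| ≤ Lu * exp (-(μ * ∑ i, (((x i - b₀ i).natAbs : ℕ) : ℝ)))) :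
    Summable (fun b'' : X d => m₁ b'' * h₁ b'') ∧ Summable (fun b'' : X d => m₂ b'' * h₂ b'') ∧
    |(v₁ - ∑' b'' : X d, m₁ b'' * h₁ b'') - (v₂ - ∑' b'' : X d, m₂ b'' * h₂ b'')|
      ≤ (Lu + (Lm * Ch + Cm * Lh) * (2 * (1 - exp (-(μ - α)))⁻¹) ^ d) * exp (-(α * ∑ i, (((x i - b₀ i).natAbs : ℕ) : ℝ))) := by
  have hLu : 0 ≤ Lu := by
    have h := (abs_nonneg _).trans hv
    exact le_of_mul_le_mul_right (by rw [zero_mul]; exact h) (exp_pos _)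
  have hS0 : ∀ b c : X d, (0 : ℝ) ≤ ∑ i, (((b i - c i).natAbs : ℕ) : ℝ) := fun b c => by positivity
  -- the bounds in the convolution's orientation
  have hm₁ : ∀ b'', |m₁ b''| ≤ (Cm + Lm) * exp (-(μ * ∑ i, (((b₀ i - b'' i).natAbs : ℕ) : ℝ))) := fun b'' => by
    rw [natAbs_sub_comm_sum b₀ b'']
    calc |m₁ b''| = |m₂ b'' + (m₁ b'' - m₂ b'')| := by ring_nf
      _ ≤ |m₂ b''| + |m₁ b'' - m₂ b''| := abs_add_le _ _
      _ ≤ _ := by rw [add_mul]; exact add_le_add (hm₂ b'') (hmd b'')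
  have hm₂' : ∀ b'', |m₂ b''| ≤ Cm * exp (-(μ * ∑ i, (((b₀ i - b'' i).natAbs : ℕ) : ℝ))) := fun b'' => by
    rw [natAbs_sub_comm_sum b₀ b'']; exact hm₂ b''
  have hmd' : ∀ b'', |m₁ b'' - m₂ b''| ≤ Lm * exp (-(μ * ∑ i, (((b₀ i - b'' i).natAbs : ℕ) : ℝ))) := fun b'' => by
    rw [natAbs_sub_comm_sum b₀ b'']; exact hmd b''
  have hh₁' : ∀ b'', |h₁ b''| ≤ Ch * exp (-(α * ∑ i, (((b'' i - x i).natAbs : ℕ) : ℝ))) := fun b'' => by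
    rw [natAbs_sub_comm_sum b'' x]; exact hh₁ b''
  have hh₂' : ∀ b'', |h₂ b''| ≤ (Ch + Lh) * exp (-(α * ∑ i, (((b'' i - x i).natAbs : ℕ) : ℝ))) := fun b'' => by
    rw [natAbs_sub_comm_sum b'' x]
    calc |h₂ b''| = |h₁ b'' - (h₁ b'' - h₂ b'')| := by ring_nf
      _ ≤ |h₁ b''| + |h₁ b'' - h₂ b''| := abs_sub _ _
      _ ≤ _ := by rw [add_mul]; exact add_le_add (hh₁ b'') (hhd b'')
  have hhd' : ∀ b'', |h₁ b'' - h₂ b''| ≤ Lh * exp (-(α * ∑ i, (((b'' i - x i).natAbs : ℕ) : ℝ))) := fun b'' => by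
    rw [natAbs_sub_comm_sum b'' x]; exact hhd b''
  -- the four series
  obtain ⟨s1, -⟩ := conv_term_le hα hαμ x b₀ h₁ m₁ hh₁' hm₁
  obtain ⟨s2, -⟩ := conv_term_le hα hαμ x b₀ h₂ m₂ hh₂' hm₂'
  obtain ⟨s3, b3⟩ := conv_term_le hα hαμ x b₀ h₁ (fun b'' => m₁ b'' - m₂ b'') hh₁' hmd'
  obtain ⟨s4, b4⟩ := conv_term_le hα hαμ x b₀ (fun b'' => h₁ b'' - h₂ b'') m₂ hhd' hm₂'
  rw [natAbs_sub_comm_sum b₀ x] at b3 b4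
  have s1' : Summable (fun b'' : X d => m₁ b'' * h₁ b'') := s1.congr fun b'' => mul_comm _ _
  have s2' : Summable (fun b'' : X d => m₂ b'' * h₂ b'') := s2.congr fun b'' => mul_comm _ _
  refine ⟨s1', s2', ?_⟩
  -- the split
  have e1 : ∑' b'' : X d, m₁ b'' * h₁ b'' - ∑' b'' : X d, m₂ b'' * h₂ b''
      = ∑' b'' : X d, h₁ b'' * (m₁ b'' - m₂ b'') + ∑' b'' : X d, (h₁ b'' - h₂ b'') * m₂ b'' := by
    rw [← s1'.tsum_sub s2', ← s3.tsum_add s4]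
    exact tsum_congr fun b'' => by ring
  have e : (v₁ - ∑' b'' : X d, m₁ b'' * h₁ b'') - (v₂ - ∑' b'' : X d, m₂ b'' * h₂ b'')
      = (v₁ - v₂) - (∑' b'' : X d, h₁ b'' * (m₁ b'' - m₂ b'') + ∑' b'' : X d, (h₁ b'' - h₂ b'') * m₂ b'') := by
    rw [← e1]; ring
  rw [e]
  have hvα : |v₁ - v₂| ≤ Lu * exp (-(α * ∑ i, (((x i - b₀ i).natAbs : ℕ) : ℝ))) :=
    hv.trans (mul_le_mul_of_nonneg_left (exp_le_exp.2 (neg_le_neg (mul_le_mul_of_nonneg_right hαμ.le (hS0 x b₀)))) hLu)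
  calc _ ≤ |v₁ - v₂| + |∑' b'' : X d, h₁ b'' * (m₁ b'' - m₂ b'') + ∑' b'' : X d, (h₁ b'' - h₂ b'') * m₂ b''| := abs_sub _ _
    _ ≤ |v₁ - v₂| + (|∑' b'' : X d, h₁ b'' * (m₁ b'' - m₂ b'')| + |∑' b'' : X d, (h₁ b'' - h₂ b'') * m₂ b''|) :=
        add_le_add le_rfl (abs_add_le _ _)
    _ ≤ Lu * exp (-(α * ∑ i, (((x i - b₀ i).natAbs : ℕ) : ℝ)))
        + (Ch * Lm * (2 * (1 - exp (-(μ - α)))⁻¹) ^ d * exp (-(α * ∑ i, (((x i - b₀ i).natAbs : ℕ) : ℝ)))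
          + Lh * Cm * (2 * (1 - exp (-(μ - α)))⁻¹) ^ d * exp (-(α * ∑ i, (((x i - b₀ i).natAbs : ℕ) : ℝ)))) :=
        add_le_add hvα (add_le_add b3 b4)
    _ = _ := by ring

/-! ## §2. The response kernels: decay and a one-rate Lipschitz bound -/

/-- **RESPONSE KERNELS, READ AT ONE RATE**: (245)'s ingredients with `0 < ν_L ≤ ν < μ` (`|N₂(b′,b″)| ≤ C_Ne^{−ν|b′−b″|₁}`, `|N₁ − N₂|(b′,b″) ≤
L_Ne^{−ν_L|b′−b″|₁}`, `|Ψ₁(b′,p)| ≤ C_Ψe^{−μ|blk n p − b′|₁}`, `|Ψ₁ − Ψ₂|(b′,p) ≤ L_Ψe^{−μ|blk n p − b′|₁}`) ⟹ both response series converge,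
`|Σ′N₁Ψ₁|(b″,p) ≤ (C_N + L_N)C_ΨK_{μ−ν_L}e^{−ν_L|blk n p − b″|₁}` and
`|Σ′N₁Ψ₁ − Σ′N₂Ψ₂|(b″,p) ≤ (L_NC_ΨK_{μ−ν_L} + C_NL_ΨK_{μ−ν})e^{−ν_L|blk n p − b″|₁}`
— (245) and one more no-loss convolution, `e^{−ν} ≤ e^{−ν_L}`. [folklore] -/
theorem response_kernel_bounds (n : ℕ) {CN ν CΨ μ LN νL LΨ : ℝ} (hν : 0 < ν) (hνμ : ν < μ) (hνL : 0 < νL) (hνLν : νL ≤ ν)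
    (N₁ N₂ Ψ₁ Ψ₂ : X d → X d → ℝ) (b'' p : X d)
    (hN₂ : ∀ b', |N₂ b' b''| ≤ CN * exp (-(ν * ∑ i, (((b' i - b'' i).natAbs : ℕ) : ℝ))))
    (hNd : ∀ b', |N₁ b' b'' - N₂ b' b''| ≤ LN * exp (-(νL * ∑ i, (((b' i - b'' i).natAbs : ℕ) : ℝ))))
    (hΨ₁ : ∀ b', |Ψ₁ b' p| ≤ CΨ * exp (-(μ * ∑ i, (((blk n p i - b' i).natAbs : ℕ) : ℝ))))
    (hΨd : ∀ b', |Ψ₁ b' p - Ψ₂ b' p| ≤ LΨ * exp (-(μ * ∑ i, (((blk n p i - b' i).natAbs : ℕ) : ℝ)))) :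
    Summable (fun b' : X d => N₁ b' b'' * Ψ₁ b' p) ∧ Summable (fun b' : X d => N₂ b' b'' * Ψ₂ b' p) ∧
    |∑' b' : X d, N₁ b' b'' * Ψ₁ b' p|
      ≤ (CN + LN) * CΨ * (2 * (1 - exp (-(μ - νL)))⁻¹) ^ d * exp (-(νL * ∑ i, (((blk n p i - b'' i).natAbs : ℕ) : ℝ))) ∧
    |∑' b' : X d, N₁ b' b'' * Ψ₁ b' p - ∑' b' : X d, N₂ b' b'' * Ψ₂ b' p|
      ≤ (LN * CΨ * (2 * (1 - exp (-(μ - νL)))⁻¹) ^ d + CN * LΨ * (2 * (1 - exp (-(μ - ν)))⁻¹) ^ d)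
        * exp (-(νL * ∑ i, (((blk n p i - b'' i).natAbs : ℕ) : ℝ))) := by
  have hνLμ : νL < μ := lt_of_le_of_lt hνLν hνμ
  obtain ⟨s1, s2, hd⟩ := response_lipschitz n hν hνμ hνL.le hνLμ N₁ N₂ Ψ₁ Ψ₂ b'' p hN₂ hNd hΨ₁ hΨd
  have hCN : 0 ≤ CN := by
    have h := (abs_nonneg _).trans (hN₂ b'')
    exact le_of_mul_le_mul_right (by rw [zero_mul]; exact h) (exp_pos _)
  have hLΨ : 0 ≤ LΨ := by
    have h := (abs_nonneg _).trans (hΨd b'')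
    exact le_of_mul_le_mul_right (by rw [zero_mul]; exact h) (exp_pos _)
  have hS0 : ∀ b c : X d, (0 : ℝ) ≤ ∑ i, (((b i - c i).natAbs : ℕ) : ℝ) := fun b c => by positivity
  have hN₁ : ∀ b', |N₁ b' b''| ≤ (CN + LN) * exp (-(νL * ∑ i, (((b' i - b'' i).natAbs : ℕ) : ℝ))) := by
    intro b'
    have e1 : exp (-(ν * ∑ i, (((b' i - b'' i).natAbs : ℕ) : ℝ))) ≤ exp (-(νL * ∑ i, (((b' i - b'' i).natAbs : ℕ) : ℝ))) :=
      exp_le_exp.2 (neg_le_neg (mul_le_mul_of_nonneg_right hνLν (hS0 b' b'')))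
    calc |N₁ b' b''| = |N₂ b' b'' + (N₁ b' b'' - N₂ b' b'')| := by ring_nf
      _ ≤ |N₂ b' b''| + |N₁ b' b'' - N₂ b' b''| := abs_add_le _ _
      _ ≤ CN * exp (-(νL * ∑ i, (((b' i - b'' i).natAbs : ℕ) : ℝ)))
          + LN * exp (-(νL * ∑ i, (((b' i - b'' i).natAbs : ℕ) : ℝ))) :=
          add_le_add ((hN₂ b').trans (mul_le_mul_of_nonneg_left e1 hCN)) (hNd b')
      _ = _ := by ring
  obtain ⟨-, b1⟩ := conv_term_le hνL.le hνLμ b'' (blk n p) (fun b' => N₁ b' b'') (fun b' => Ψ₁ b' p) hN₁ hΨ₁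
  refine ⟨s1, s2, b1, hd.trans ?_⟩
  have hK : 0 < (2 * (1 - exp (-(μ - ν)))⁻¹) ^ d := K_pos (d := d) (sub_pos.2 hνμ)
  have e1 : exp (-(ν * ∑ i, (((blk n p i - b'' i).natAbs : ℕ) : ℝ)))
      ≤ exp (-(νL * ∑ i, (((blk n p i - b'' i).natAbs : ℕ) : ℝ))) :=
    exp_le_exp.2 (neg_le_neg (mul_le_mul_of_nonneg_right hνLν (hS0 (blk n p) b'')))
  have h2 := mul_le_mul_of_nonneg_left e1 (by positivity : 0 ≤ CN * LΨ * (2 * (1 - exp (-(μ - ν)))⁻¹) ^ d)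
  rw [add_mul]
  exact add_le_add le_rfl h2

/-! ## §3. The solutions of `(H_V + K)u = f` are Lipschitz in `V` -/

/-- **SOLUTIONS AND THEIR BLOCK MEANS ARE LIPSCHITZ IN `V`**: `d ≥ 3`, `a > 0`, `λ < min(2,a)`, `Λ ≥ 0` ⟹ `∃ C₀′ C_P′ δ₀′ > 0` ((216)'s)
such that for ALL `n`, potentials `V₁, V₂ : ℤ^d → [−λ, Λ]` with `|V₁ − V₂| ≤ D`, `0 < μ < min(δ₀′, γ)`, `ε ≥ 0` under (216)'s two smallness
conditions, kernels of the class, every `b₀`, every source `f` and solutions `u₁` (bounded) of `(H_{V₁} + K)u₁ = f`, `u₂` (block profile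
`C_ue^{−μ|blk n p − b₀|₁}`) of `(H_{V₂} + K)u₂ = f`: `|u₁ − u₂|(p) ≤ 2C_P′K_{δ₀′−μ}DC_ue^{−μ|blk n p − b₀|₁}`, the block means differ by at most
`2C_P′K_{δ₀′−μ}DC_ue^{−μ|b−b₀|₁}`, and `u₂`'s block means are `≤ C_ue^{−μ|b−b₀|₁}` — (235) §1 (`(H_{V₁} + K)(u₁ − u₂) = (V₂ − V₁)u₂`) and (216)'s
profile lemma for ANY bounded solution. [folklore] -/
theorem zd_perturbed_solution_lipschitz_potential (hd : 3 ≤ d) (a : ℝ) (ha : 0 < a) {lam Lam : ℝ} (hlam : lam < min 2 a)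
    (hLam : 0 ≤ Lam) :
    ∃ C₀' CP' δ₀' : ℝ, 0 < C₀' ∧ 0 < CP' ∧ 0 < δ₀' ∧
    ∀ (n : ℕ) (V₁ V₂ : X d → ℝ), (∀ p, -lam ≤ V₁ p) → (∀ p, V₁ p ≤ Lam) → (∀ p, -lam ≤ V₂ p) → (∀ p, V₂ p ≤ Lam) →
    ∀ D : ℝ, (∀ p, |V₁ p - V₂ p| ≤ D) →
    ∀ (ε γ μ : ℝ), 0 ≤ ε → 0 < μ → μ < δ₀' → μ < γ →
      ε * (2 * (1 - exp (-γ))⁻¹) ^ d * C₀' ≤ 1 / 2 →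
      (CP' * (2 * (1 - exp (-(δ₀' - μ)))⁻¹) ^ d) * (ε * exp (μ * d) * (2 * (1 - exp (-(γ - μ)))⁻¹) ^ d) ≤ 1 / 2 →
    ∀ (K : X d → X d → ℝ), (∀ p q, |K p q| ≤ ε * exp (-(γ * ∑ i, (((p i - q i).natAbs : ℕ) : ℝ)))) →
    ∀ (b₀ : X d) (f u₁ u₂ : X d → ℝ) (B₁ Cu : ℝ), (∀ p, |u₁ p| ≤ B₁) →
      (∀ p, |u₂ p| ≤ Cu * exp (-(μ * ∑ i, (((blk n p i - b₀ i).natAbs : ℕ) : ℝ)))) →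
      (∀ p, ((n : ℝ) + 1) ^ 2 * ∑ μ', (2 * u₁ p - u₁ (p + e μ') - u₁ (p - e μ'))
        + a / ((n : ℝ) + 1) ^ d * ∑ q ∈ B n (blk n p), u₁ q + V₁ p * u₁ p + ∑' q : X d, K p q * u₁ q = f p) →
      (∀ p, ((n : ℝ) + 1) ^ 2 * ∑ μ', (2 * u₂ p - u₂ (p + e μ') - u₂ (p - e μ'))
        + a / ((n : ℝ) + 1) ^ d * ∑ q ∈ B n (blk n p), u₂ q + V₂ p * u₂ p + ∑' q : X d, K p q * u₂ q = f p) →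
      (∀ p, |u₁ p - u₂ p| ≤ 2 * (CP' * (2 * (1 - exp (-(δ₀' - μ)))⁻¹) ^ d) * (D * Cu)
          * exp (-(μ * ∑ i, (((blk n p i - b₀ i).natAbs : ℕ) : ℝ)))) ∧
      (∀ b, |(((n : ℝ) + 1) ^ d)⁻¹ * ∑ q ∈ B n b, u₁ q - (((n : ℝ) + 1) ^ d)⁻¹ * ∑ q ∈ B n b, u₂ q|
          ≤ 2 * (CP' * (2 * (1 - exp (-(δ₀' - μ)))⁻¹) ^ d) * (D * Cu) * exp (-(μ * ∑ i, (((b i - b₀ i).natAbs : ℕ) : ℝ)))) ∧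
      (∀ b, |(((n : ℝ) + 1) ^ d)⁻¹ * ∑ q ∈ B n b, u₂ q| ≤ Cu * exp (-(μ * ∑ i, (((b i - b₀ i).natAbs : ℕ) : ℝ)))) := by
  classical
  obtain ⟨C₀, CP, δ₀, hC₀, hCP, hδ₀, H216⟩ := zd_perturbed_profile (d := d) hd a ha hlam hLam
  refine ⟨C₀, CP, δ₀, hC₀, hCP, hδ₀, ?_⟩
  intro n V₁ V₂ hV₁ hV₁' _ _ D hD ε γ μ hε hμ hμδ hμγ hs1 hs2 K hK b₀ f u₁ u₂ B₁ Cu hu₁B hu₂B hu₁ hu₂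
  have hγ : 0 < γ := hμ.trans hμγ
  have hCu : 0 ≤ Cu := by
    have h := (abs_nonneg _).trans (hu₂B 0)
    exact le_of_mul_le_mul_right (by rw [zero_mul]; exact h) (exp_pos _)
  have hu₂b : ∀ p, |u₂ p| ≤ Cu := fun p =>
    (hu₂B p).trans (mul_le_of_le_one_right hCu (exp_le_one_iff.2 (by rw [neg_nonpos]; positivity)))
  have hP := (H216 n V₁ hV₁ hV₁' ε γ μ hε hμ hμδ hμγ hs1 hs2 K hK).2
  have hg : ∀ p, |(V₂ p - V₁ p) * u₂ p| ≤ (D * Cu) * exp (-(μ * ∑ i, (((blk n p i - b₀ i).natAbs : ℕ) : ℝ))) := by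
    intro p
    rw [abs_mul, abs_sub_comm, mul_assoc]
    exact mul_le_mul (hD p) (hu₂B p) (abs_nonneg _) ((abs_nonneg _).trans (hD p))
  have hwB : ∀ p, |u₁ p - u₂ p| ≤ B₁ + Cu := fun p => (abs_sub _ _).trans (add_le_add (hu₁B p) (hu₂b p))
  have hw := perturbed_difference_equation n a hγ V₁ V₂ K hK u₁ u₂ f hu₁B hu₂b hu₁ hu₂
  have hcol : ∀ p, |u₁ p - u₂ p| ≤ 2 * (CP * (2 * (1 - exp (-(δ₀ - μ)))⁻¹) ^ d) * (D * Cu)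
      * exp (-(μ * ∑ i, (((blk n p i - b₀ i).natAbs : ℕ) : ℝ))) :=
    hP b₀ (D * Cu) (fun p => (V₂ p - V₁ p) * u₂ p) hg (fun p => u₁ p - u₂ p) (B₁ + Cu) hwB hw
  refine ⟨hcol, fun b => ?_, fun b => coarse_entry_le n (fun (_ : X d) q => u₂ q) b₀ hu₂B b⟩
  have h := coarse_entry_le n (fun (_ : X d) q => u₁ q - u₂ q) b₀ hcol b
  have e1 : (((n : ℝ) + 1) ^ d)⁻¹ * ∑ q ∈ B n b, (u₁ q - u₂ q)
      = (((n : ℝ) + 1) ^ d)⁻¹ * ∑ q ∈ B n b, u₁ q - (((n : ℝ) + 1) ^ d)⁻¹ * ∑ q ∈ B n b, u₂ q := by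
    rw [Finset.sum_sub_distrib, mul_sub]
  rw [e1] at h
  exact h

/-! ## §4. THE END: the response and the fluctuation covariance are Lipschitz in `V` -/

/-- **HEADLINE — THE `H + K` COLUMN'S RESPONSE AND FLUCTUATION COVARIANCE ARE LIPSCHITZ IN `V` ON `ℤ^d`**: `d ≥ 3`, `a > 0`,
`λ < min(2,a)`, `Λ ≥ 0` ⟹ `∃ C₀ C_P δ₀ C₀′ C_P′ δ₀′ > 0` ((216)'s triple twice: for the columns via (235), for the solutions via §3) such that for
ALL `n`, `V₁, V₂ : ℤ^d → [−λ, Λ]` with `|V₁ − V₂| ≤ D`, rates `0 < ν < μ < min(δ₀, δ₀′, γ)`, `ε ≥ 0` under the two + two smallness conditions,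
kernels `|K(p,q)| ≤ εe^{−γ|p−q|₁}`, ANY perturbed block columns `Ψ^K_1, Ψ^K_2` (block profile `C_Ψ`, the `V_j`-equations) with ANY decaying
`N₁` (LEFT inverse of `T_{K,1}`), `N₂` (RIGHT inverse of `T_{K,2}`) (`|N_j| ≤ C_Ne^{−ν|b−c|₁}`) — (235)'s objects —, every `b₀`, source `f`,
bounded `u₁` with `(H_{V₁} + K)u₁ = f` and `u₂` of block profile `C_ue^{−μ|blk n p − b₀|₁}` with `(H_{V₂} + K)u₂ = f`, and every `p`:
(ii) for every `b″` both response series `h_j(b″,p) = Σ′N_j(b′,b″)Ψ^K_j(b′,p)` converge and `|h₁ − h₂|(b″,p) ≤ L_he^{−(ν∕4)|blk n p − b″|₁}` with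
`L_h = L_NC_ΨK_{μ−ν∕4} + C_NL_ΨK_{μ−ν}`, `L_Ψ = 2C_PK_{δ₀−μ}DC_Ψ`, `L_N = C_N²L_ΨK_{ν∕2}K_{ν∕4}` ((235)'s); (iii) both series `Σ″m_j(b″)h_j(b″,p)`
converge and the fluctuation parts satisfy `|(u₁ − Σ″m₁h₁)(p) − (u₂ − Σ″m₂h₂)(p)| ≤ (L_u + (L_uC_h + C_uL_h)K_{μ−ν∕4})e^{−(ν∕4)|blk n p − b₀|₁}`,
`L_u = 2C_P′K_{δ₀′−μ}DC_u`, `C_h = (C_N + L_N)C_ΨK_{μ−ν∕4}` — every `L` carries the factor `D`.  (235) + §2 + §3 + §1. [folklore] -/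
theorem zd_perturbed_covariance_lipschitz_potential (hd : 3 ≤ d) (a : ℝ) (ha : 0 < a) {lam Lam : ℝ} (hlam : lam < min 2 a)
    (hLam : 0 ≤ Lam) :
    ∃ C₀ CP δ₀ C₀' CP' δ₀' : ℝ, 0 < C₀ ∧ 0 < CP ∧ 0 < δ₀ ∧ 0 < C₀' ∧ 0 < CP' ∧ 0 < δ₀' ∧
    ∀ (n : ℕ) (V₁ V₂ : X d → ℝ), (∀ p, -lam ≤ V₁ p) → (∀ p, V₁ p ≤ Lam) → (∀ p, -lam ≤ V₂ p) → (∀ p, V₂ p ≤ Lam) →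
    ∀ D : ℝ, (∀ p, |V₁ p - V₂ p| ≤ D) →
    ∀ (ε γ μ ν : ℝ), 0 ≤ ε → 0 < μ → μ < δ₀ → μ < γ → 0 < ν → ν < μ →
      ε * (2 * (1 - exp (-γ))⁻¹) ^ d * C₀ ≤ 1 / 2 →
      (CP * (2 * (1 - exp (-(δ₀ - μ)))⁻¹) ^ d) * (ε * exp (μ * d) * (2 * (1 - exp (-(γ - μ)))⁻¹) ^ d) ≤ 1 / 2 →
      μ < δ₀' → ε * (2 * (1 - exp (-γ))⁻¹) ^ d * C₀' ≤ 1 / 2 →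
      (CP' * (2 * (1 - exp (-(δ₀' - μ)))⁻¹) ^ d) * (ε * exp (μ * d) * (2 * (1 - exp (-(γ - μ)))⁻¹) ^ d) ≤ 1 / 2 →
    ∀ (K : X d → X d → ℝ), (∀ p q, |K p q| ≤ ε * exp (-(γ * ∑ i, (((p i - q i).natAbs : ℕ) : ℝ)))) →
    ∀ (ΨK₁ ΨK₂ : X d → X d → ℝ) (CΨ : ℝ),
      (∀ c p, |ΨK₁ c p| ≤ CΨ * exp (-(μ * ∑ i, (((blk n p i - c i).natAbs : ℕ) : ℝ)))) →
      (∀ c p, |ΨK₂ c p| ≤ CΨ * exp (-(μ * ∑ i, (((blk n p i - c i).natAbs : ℕ) : ℝ)))) →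
      (∀ c p, ((n : ℝ) + 1) ^ 2 * ∑ μ', (2 * ΨK₁ c p - ΨK₁ c (p + e μ') - ΨK₁ c (p - e μ'))
        + a / ((n : ℝ) + 1) ^ d * ∑ q ∈ B n (blk n p), ΨK₁ c q + V₁ p * ΨK₁ c p + ∑' q : X d, K p q * ΨK₁ c q
          = if blk n p = c then 1 else 0) →
      (∀ c p, ((n : ℝ) + 1) ^ 2 * ∑ μ', (2 * ΨK₂ c p - ΨK₂ c (p + e μ') - ΨK₂ c (p - e μ'))
        + a / ((n : ℝ) + 1) ^ d * ∑ q ∈ B n (blk n p), ΨK₂ c q + V₂ p * ΨK₂ c p + ∑' q : X d, K p q * ΨK₂ c q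
          = if blk n p = c then 1 else 0) →
    ∀ (N₁ N₂ : X d → X d → ℝ) (CN : ℝ), 0 ≤ CN →
      (∀ b c, |N₁ b c| ≤ CN * exp (-(ν * ∑ i, (((b i - c i).natAbs : ℕ) : ℝ)))) →
      (∀ b c, |N₂ b c| ≤ CN * exp (-(ν * ∑ i, (((b i - c i).natAbs : ℕ) : ℝ)))) →
      (∀ b c, ∑' b' : X d, N₁ b b' * (((((n : ℝ) + 1) ^ d)⁻¹ * ∑ q ∈ B n b', ΨK₁ c q)) = if b = c then 1 else 0) →
      (∀ b c, ∑' b' : X d, (((((n : ℝ) + 1) ^ d)⁻¹ * ∑ q ∈ B n b, ΨK₂ b' q)) * N₂ b' c = if b = c then 1 else 0) →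
    ∀ (b₀ : X d) (f u₁ u₂ : X d → ℝ) (B₁ Cu : ℝ), (∀ p, |u₁ p| ≤ B₁) →
      (∀ p, |u₂ p| ≤ Cu * exp (-(μ * ∑ i, (((blk n p i - b₀ i).natAbs : ℕ) : ℝ)))) →
      (∀ p, ((n : ℝ) + 1) ^ 2 * ∑ μ', (2 * u₁ p - u₁ (p + e μ') - u₁ (p - e μ'))
        + a / ((n : ℝ) + 1) ^ d * ∑ q ∈ B n (blk n p), u₁ q + V₁ p * u₁ p + ∑' q : X d, K p q * u₁ q = f p) →
      (∀ p, ((n : ℝ) + 1) ^ 2 * ∑ μ', (2 * u₂ p - u₂ (p + e μ') - u₂ (p - e μ'))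
        + a / ((n : ℝ) + 1) ^ d * ∑ q ∈ B n (blk n p), u₂ q + V₂ p * u₂ p + ∑' q : X d, K p q * u₂ q = f p) →
    ∀ p : X d,
      -- (ii) the response kernels are Lipschitz in `V`
      (∀ b'' : X d, Summable (fun b' : X d => N₁ b' b'' * ΨK₁ b' p) ∧ Summable (fun b' : X d => N₂ b' b'' * ΨK₂ b' p) ∧
        |∑' b' : X d, N₁ b' b'' * ΨK₁ b' p - ∑' b' : X d, N₂ b' b'' * ΨK₂ b' p|
          ≤ (CN ^ 2 * (2 * (CP * (2 * (1 - exp (-(δ₀ - μ)))⁻¹) ^ d) * (D * CΨ) * (2 * (1 - exp (-(ν / 2)))⁻¹) ^ d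
                * (2 * (1 - exp (-(ν / 2 / 2)))⁻¹) ^ d) * CΨ * (2 * (1 - exp (-(μ - ν / 2 / 2)))⁻¹) ^ d
              + CN * (2 * (CP * (2 * (1 - exp (-(δ₀ - μ)))⁻¹) ^ d) * (D * CΨ)) * (2 * (1 - exp (-(μ - ν)))⁻¹) ^ d)
            * exp (-(ν / 2 / 2 * ∑ i, (((blk n p i - b'' i).natAbs : ℕ) : ℝ)))) ∧
      -- (iii) the fluctuation covariance is Lipschitz in `V`
      Summable (fun b'' : X d => ((((n : ℝ) + 1) ^ d)⁻¹ * ∑ q ∈ B n b'', u₁ q) * ∑' b' : X d, N₁ b' b'' * ΨK₁ b' p) ∧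
      Summable (fun b'' : X d => ((((n : ℝ) + 1) ^ d)⁻¹ * ∑ q ∈ B n b'', u₂ q) * ∑' b' : X d, N₂ b' b'' * ΨK₂ b' p) ∧
      |(u₁ p - ∑' b'' : X d, ((((n : ℝ) + 1) ^ d)⁻¹ * ∑ q ∈ B n b'', u₁ q) * ∑' b' : X d, N₁ b' b'' * ΨK₁ b' p)
          - (u₂ p - ∑' b'' : X d, ((((n : ℝ) + 1) ^ d)⁻¹ * ∑ q ∈ B n b'', u₂ q) * ∑' b' : X d, N₂ b' b'' * ΨK₂ b' p)|
        ≤ ((2 * (CP' * (2 * (1 - exp (-(δ₀' - μ)))⁻¹) ^ d) * (D * Cu))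
            + ((2 * (CP' * (2 * (1 - exp (-(δ₀' - μ)))⁻¹) ^ d) * (D * Cu))
                  * ((CN + CN ^ 2 * (2 * (CP * (2 * (1 - exp (-(δ₀ - μ)))⁻¹) ^ d) * (D * CΨ) * (2 * (1 - exp (-(ν / 2)))⁻¹) ^ d
                      * (2 * (1 - exp (-(ν / 2 / 2)))⁻¹) ^ d)) * CΨ * (2 * (1 - exp (-(μ - ν / 2 / 2)))⁻¹) ^ d)
                + Cu * (CN ^ 2 * (2 * (CP * (2 * (1 - exp (-(δ₀ - μ)))⁻¹) ^ d) * (D * CΨ) * (2 * (1 - exp (-(ν / 2)))⁻¹) ^ d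
                      * (2 * (1 - exp (-(ν / 2 / 2)))⁻¹) ^ d) * CΨ * (2 * (1 - exp (-(μ - ν / 2 / 2)))⁻¹) ^ d
                    + CN * (2 * (CP * (2 * (1 - exp (-(δ₀ - μ)))⁻¹) ^ d) * (D * CΨ)) * (2 * (1 - exp (-(μ - ν)))⁻¹) ^ d))
              * (2 * (1 - exp (-(μ - ν / 2 / 2)))⁻¹) ^ d)
          * exp (-(ν / 2 / 2 * ∑ i, (((blk n p i - b₀ i).natAbs : ℕ) : ℝ))) := by
  classical
  obtain ⟨C₀, CP, δ₀, hC₀, hCP, hδ₀, H235⟩ := zd_perturbed_hessian_lipschitz_potential (d := d) hd a ha hlam hLam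
  obtain ⟨C₀', CP', δ₀', hC₀', hCP', hδ₀', H3⟩ := zd_perturbed_solution_lipschitz_potential (d := d) hd a ha hlam hLam
  refine ⟨C₀, CP, δ₀, C₀', CP', δ₀', hC₀, hCP, hδ₀, hC₀', hCP', hδ₀', ?_⟩
  intro n V₁ V₂ hV₁ hV₁' hV₂ hV₂' D hD ε γ μ ν hε hμ hμδ hμγ hν hνμ hs1 hs2 hμδ' hs1' hs2' K hK ΨK₁ ΨK₂ CΨ hΨ₁B hΨ₂B hΨ₁ hΨ₂
    N₁ N₂ CN hCN hN₁ hN₂ hN₁T hTN₂ b₀ f u₁ u₂ B₁ Cu hu₁B hu₂B hu₁ hu₂ p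
  obtain ⟨hcol, -, hNd⟩ := H235 n V₁ V₂ hV₁ hV₁' hV₂ hV₂' D hD ε γ μ ν hε hμ hμδ hμγ hν hνμ hs1 hs2 K hK ΨK₁ ΨK₂ CΨ
    hΨ₁B hΨ₂B hΨ₁ hΨ₂ N₁ N₂ CN hCN hN₁ hN₂ hN₁T hTN₂
  obtain ⟨hud, hmd, hm₂⟩ := H3 n V₁ V₂ hV₁ hV₁' hV₂ hV₂' D hD ε γ μ hε hμ hμδ' hμγ hs1' hs2' K hK b₀ f u₁ u₂ B₁ Cu
    hu₁B hu₂B hu₁ hu₂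
  have hνL : 0 < ν / 2 / 2 := by positivity
  have hνLν : ν / 2 / 2 ≤ ν := by linarith
  have hνLμ : ν / 2 / 2 < μ := by linarith
  have hR := fun b'' : X d => response_kernel_bounds n hν hνμ hνL hνLν N₁ N₂ ΨK₁ ΨK₂ b'' p (fun b' => hN₂ b' b'')
    (fun b' => hNd b' b'') (fun b' => hΨ₁B b' p) (fun b' => hcol b' p)
  refine ⟨fun b'' => ⟨(hR b'').1, (hR b'').2.1, (hR b'').2.2.2⟩, ?_⟩
  exact fluctuation_split hνL.le hνLμ (fun b'' => ((((n : ℝ) + 1) ^ d)⁻¹ * ∑ q ∈ B n b'', u₁ q)) (fun b'' => ((((n : ℝ) + 1) ^ d)⁻¹ * ∑ q ∈ B n b'', u₂ q))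
    (fun b'' => ∑' b' : X d, N₁ b' b'' * ΨK₁ b' p) (fun b'' => ∑' b' : X d, N₂ b' b'' * ΨK₂ b' p) (blk n p) b₀ (u₁ p) (u₂ p)
    hm₂ hmd (fun b'' => (hR b'').2.2.1) (fun b'' => (hR b'').2.2.2) (hud p)

/-! ## §5. Toy -/

/-- Toy (`d = 3`, `a = 1`, `λ = 0`, `Λ = 1`): the six constants exist. -/
example : ∃ C₀ CP δ₀ C₀' CP' δ₀' : ℝ, 0 < C₀ ∧ 0 < CP ∧ 0 < δ₀ ∧ 0 < C₀' ∧ 0 < CP' ∧ 0 < δ₀' :=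
  let ⟨C₀, CP, δ₀, C₀', CP', δ₀', h1, h2, h3, h4, h5, h6, _⟩ :=
    zd_perturbed_covariance_lipschitz_potential (d := 3) le_rfl 1 one_pos (lam := 0) (Lam := 1)
      (by rw [min_eq_right (by norm_num : (1 : ℝ) ≤ 2)]; norm_num) zero_le_one
  ⟨C₀, CP, δ₀, C₀', CP', δ₀', h1, h2, h3, h4, h5, h6⟩

end Summit.QuantumFields.BalabanUV.T4Continuum.NE7b.SupZdPerturbedCovariancePotentialLipschitz
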